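/-
Copyright (c) 2026 the pub-hodgecm-mathlib formalisation cell (harness21).  Prover seat hodgecm-mathlib-K2E1b-p01 (g3), Track B «K2-LIT» ∕ h413
(`stmt-HodgeConjecture-24833`), line `K2_E3_EllipticInputs`, unit U3, line U3-d (lead K2E3-p03): FILE C rung C2 — the REGULAR unipotent class, part (ii)-b₁:
the index of the weight map on a coordinate box of the centraliser.  2026-09-04.
-/
import Mathlib.GroupTheory.Index
import Mathlib.Algebra.Group.Subgroup.Map
import Mathlib.Algebra.Group.TypeTags.Hom
import Mathlib.Algebra.Field.Basic
import HarnessLib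

/-!
# K2_E3 road (h413 = stmt-HodgeConjecture-24833), U3-d FILE C, rung C2 «REGULAR UNIPOTENT CLASS» — part (ii)-b₁: THE INDEX `[D : φD] = [O⁺ : sO⁺]·[O⁻ : s²O⁻]`
# OF THE WEIGHT MAP ON A COORDINATE BOX (pure group theory)

Cell `pub/hodgecm-mathlib` (D-0151), Track B; line lead K2E3-p03 (g0) (letters 2026-09-03T23:06Z: `Q := (Nat.card 𝓀[K])^k`, `a(regular) = 3`); dealer K2E3-plan (g1).
ABSTRACT SETTING (no matrices, no topology): a group `Z` (the centraliser `Z(u₀)`, ★ `K2E3UnipotentOrbitalScalingRegularCentralizer.exists_centralizer_coords`)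
with two homomorphisms `Θ₁ Θ₂ : Z →* Multiplicative K` (the coordinates `β`, `ζ`) which are JOINTLY SURJECTIVE onto `O⁺ × O⁻`-type sets, an automorphism `φ` of `Z`
(conjugation by the normalising `h`) acting by the WEIGHTS `Θ₁ ∘ φ = s·Θ₁`, `Θ₂ ∘ φ = s²·Θ₂`, and two additive subgroups `O⁺, O⁻ ≤ K` stable under `s·`.  Then for the
BOX `D := Θ₁⁻¹(O⁺) ⊓ Θ₂⁻¹(O⁻)`:
* §1 `map_box_eq` — `φ(D) = Θ₁⁻¹(s·O⁺) ⊓ Θ₂⁻¹(s²·O⁻)`;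
* §2 `relIndex_box_eq_mul` — `[D : φD] = [O⁺ : s·O⁺] · [O⁻ : s²·O⁻]` (Mathlib `Subgroup.relIndex_inf_mul_relIndex`, `Subgroup.relIndex_comap`,
  `AddSubgroup.relIndex_toSubgroup`; the images are the full balls by joint surjectivity);
* §3 `relIndex_smul_sq`, `relIndex_smul_sq_sq` — `[O : s·O] = [O : t·O]²` and `[O : s²·O] = [O : s·O]²` for `s = t·t` (Mathlib `AddSubgroup.relIndex_map_map_of_injective`,
  `relIndex_mul_relIndex`), so with the frame's index letters (★ `K2E3LocalLatticeScalingIndex`: `[O⁺ : tO⁺]² = Q`, `[O⁻ : t²O⁻] = Q`) **`[D : φD] = Q·Q² = Q³`**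
  (`relIndex_box_eq_pow_three`) — the exponent `a(regular) = 3` of the line lead's token.
Part (ii)-b₂ (`K2E3UnipotentOrbitalScalingRegularHaar`) adds the topology (the box is compact open in `Z(u₀)`) and Haar measure.

THEOREMS ONLY (no definition ∕ instance ∕ notation ∕ named fact ∕ `sorry`); Mathlib-only imports.  HONEST LABEL: HC_CM is proved only modulo the 7 printed citations
(2 remaining named inputs: hLiu418 = stmt-HodgeConjecture-24832, h413 = stmt-HodgeConjecture-24833) until rung 0 closes; count-neutral helper of the U3-d line.

## References
* [HarishChandra1999AdmissibleDistributions] Harish-Chandra, *Admissible Invariant Distributions on Reductive p-adic Groups*, ULS 16 (1999), §3.1 Lemma 3.2.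
* [Rogawski1990] J. D. Rogawski, *Automorphic Representations of Unitary Groups in Three Variables* (1990), §8.1 Prop. 8.1.2 (b) p. 114 (`d(u)` for the regular class).
* [DummitFoote2004] D. S. Dummit, R. M. Foote, *Abstract Algebra*, 3rd ed. (2004), §3.3 (index computations through homomorphisms).
-/

set_option autoImplicit false
-- the mandated namespace repeats the single-problem summit's segment (`HodgeConjecture.HodgeConjecture`), as in every `Theorems/*.lean` of this sub-problem
set_option linter.dupNamespace false

namespace Summit.HodgeConjecture.HodgeConjecture.Cruxes.H413.K2E3UnipotentOrbitalScalingRegularIndex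

section Box

variable {Z : Type*} [Group Z] {K : Type*} [Field K] (σ : K →+* K) (Θ₁ Θ₂ : Z →* Multiplicative K) (φ : Z ≃* Z) {s : K}
  (Op Om : AddSubgroup K)
  (hOp : ∀ x, x ∈ Op → σ x = x) (hOm : ∀ x, x ∈ Om → σ x = -x)
  (hsurj : ∀ β ζ : K, σ β = β → σ ζ = -ζ → ∃ z : Z, (Θ₁ z).toAdd = β ∧ (Θ₂ z).toAdd = ζ)
  (hw₁ : ∀ z : Z, (Θ₁ (φ z)).toAdd = s * (Θ₁ z).toAdd) (hw₂ : ∀ z : Z, (Θ₂ (φ z)).toAdd = s ^ 2 * (Θ₂ z).toAdd)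

/-- Membership in a coordinate box `Θ₁⁻¹(A) ⊓ Θ₂⁻¹(B)`. [cite: DummitFoote2004, §3.3] -/
theorem mem_box_iff (A B : AddSubgroup K) (z : Z) :
    z ∈ (AddSubgroup.toSubgroup A).comap Θ₁ ⊓ (AddSubgroup.toSubgroup B).comap Θ₂ ↔ (Θ₁ z).toAdd ∈ A ∧ (Θ₂ z).toAdd ∈ B := by
  rw [Subgroup.mem_inf, Subgroup.mem_comap, Subgroup.mem_comap, Multiplicative.mem_toSubgroup, Multiplicative.mem_toSubgroup]

/-- Membership in a scaled additive subgroup `c·A = A.map (mulLeft c)` (`c ≠ 0`): `x ∈ c·A ↔ c⁻¹x ∈ A`. [cite: DummitFoote2004, §3.3] -/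
theorem mem_map_mulLeft_iff {c : K} (hc : c ≠ 0) (A : AddSubgroup K) (x : K) :
    x ∈ A.map (AddMonoidHom.mulLeft c) ↔ c⁻¹ * x ∈ A := by
  constructor
  · rintro ⟨y, hy, rfl⟩
    rwa [AddMonoidHom.coe_mulLeft, ← mul_assoc, inv_mul_cancel₀ hc, one_mul]
  · intro h
    exact ⟨c⁻¹ * x, h, by rw [AddMonoidHom.coe_mulLeft, ← mul_assoc, mul_inv_cancel₀ hc, one_mul]⟩

/-! ## §1 The image of the box under the weight map -/

include hw₁ hw₂ in
/-- **`φ(D) = Θ₁⁻¹(s·O⁺) ⊓ Θ₂⁻¹(s²·O⁻)`** for the box `D = Θ₁⁻¹(O⁺) ⊓ Θ₂⁻¹(O⁻)` under an automorphism `φ` with weights `(s, s²)` on `(Θ₁, Θ₂)` (`s ≠ 0`).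
[cite: HarishChandra1999AdmissibleDistributions, §3.1 Lemma 3.2] [cite: DummitFoote2004, §3.3] -/
theorem map_box_eq (hs : s ≠ 0) :
    ((AddSubgroup.toSubgroup Op).comap Θ₁ ⊓ (AddSubgroup.toSubgroup Om).comap Θ₂).map φ.toMonoidHom =
      (AddSubgroup.toSubgroup (Op.map (AddMonoidHom.mulLeft s))).comap Θ₁ ⊓
        (AddSubgroup.toSubgroup (Om.map (AddMonoidHom.mulLeft (s ^ 2)))).comap Θ₂ := by
  have hs2 : s ^ 2 ≠ 0 := pow_ne_zero 2 hs
  ext w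
  rw [Subgroup.mem_map, mem_box_iff, mem_map_mulLeft_iff hs, mem_map_mulLeft_iff hs2]
  constructor
  · rintro ⟨z, hz, rfl⟩
    rw [mem_box_iff] at hz
    rw [MulEquiv.coe_toMonoidHom, hw₁ z, hw₂ z, ← mul_assoc, ← mul_assoc, inv_mul_cancel₀ hs, inv_mul_cancel₀ hs2, one_mul, one_mul]
    exact hz
  · rintro ⟨h₁, h₂⟩
    refine ⟨φ.symm w, ?_, by simp⟩
    have e₁ : (Θ₁ (φ.symm w)).toAdd = s⁻¹ * (Θ₁ w).toAdd := by
      have h := hw₁ (φ.symm w)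
      rw [MulEquiv.apply_symm_apply] at h
      rw [h, ← mul_assoc, inv_mul_cancel₀ hs, one_mul]
    have e₂ : (Θ₂ (φ.symm w)).toAdd = (s ^ 2)⁻¹ * (Θ₂ w).toAdd := by
      have h := hw₂ (φ.symm w)
      rw [MulEquiv.apply_symm_apply] at h
      rw [h, ← mul_assoc, inv_mul_cancel₀ hs2, one_mul]
    rw [mem_box_iff, e₁, e₂]
    exact ⟨h₁, h₂⟩

/-! ## §2 The index of the scaled box -/

include hOp hOm hsurj in
/-- **`[Θ₁⁻¹(A) ⊓ Θ₂⁻¹(B) : Θ₁⁻¹(A′) ⊓ Θ₂⁻¹(B′)] = [A : A′]·[B : B′]`** for additive subgroups `A ≤ O⁺`-type (`σ`-fixed) and `B ≤ O⁻`-type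
(`σ`-anti-fixed) sets and any `A′`, `B′`, when `(Θ₁, Θ₂)` is jointly surjective onto (fixed) × (anti-fixed) (so each projection of the box is the full ball).  Two applications of
Mathlib's `relIndex_inf_mul_relIndex` and `relIndex_comap`. [cite: DummitFoote2004, §3.3 (index through a surjective homomorphism)] -/
theorem relIndex_box_eq_mul {A A' B B' : AddSubgroup K} (hA : A ≤ Op) (hB : B ≤ Om) :
    ((AddSubgroup.toSubgroup A').comap Θ₁ ⊓ (AddSubgroup.toSubgroup B').comap Θ₂).relIndex
        ((AddSubgroup.toSubgroup A).comap Θ₁ ⊓ (AddSubgroup.toSubgroup B).comap Θ₂) =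
      A'.relIndex A * B'.relIndex B := by
  -- the two images are the full balls, by joint surjectivity
  have himB : ((AddSubgroup.toSubgroup A).comap Θ₁ ⊓ (AddSubgroup.toSubgroup B).comap Θ₂).map Θ₂ = AddSubgroup.toSubgroup B := by
    ext y
    rw [Subgroup.mem_map, Multiplicative.mem_toSubgroup]
    constructor
    · rintro ⟨z, hz, rfl⟩
      exact ((mem_box_iff Θ₁ Θ₂ A B z).1 hz).2
    · intro hy
      obtain ⟨z, h1, h2⟩ := hsurj 0 y.toAdd (map_zero σ) (hOm _ (hB hy))
      refine ⟨z, (mem_box_iff Θ₁ Θ₂ A B z).2 ⟨by rw [h1]; exact A.zero_mem, by rw [h2]; exact hy⟩, ?_⟩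
      exact Multiplicative.toAdd.injective h2
  have himA : ((AddSubgroup.toSubgroup B').comap Θ₂ ⊓ ((AddSubgroup.toSubgroup A).comap Θ₁ ⊓ (AddSubgroup.toSubgroup B).comap Θ₂)).map Θ₁ =
      AddSubgroup.toSubgroup A := by
    ext y
    rw [Subgroup.mem_map, Multiplicative.mem_toSubgroup]
    constructor
    · rintro ⟨z, hz, rfl⟩
      exact ((mem_box_iff Θ₁ Θ₂ A B z).1 (Subgroup.mem_inf.1 hz).2).1
    · intro hy
      obtain ⟨z, h1, h2⟩ := hsurj y.toAdd 0 (hOp _ (hA hy)) (by rw [map_zero, neg_zero])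
      refine ⟨z, Subgroup.mem_inf.2 ⟨?_, (mem_box_iff Θ₁ Θ₂ A B z).2 ⟨by rw [h1]; exact hy, by rw [h2]; exact B.zero_mem⟩⟩, ?_⟩
      · rw [Subgroup.mem_comap, Multiplicative.mem_toSubgroup, h2]; exact B'.zero_mem
      · exact Multiplicative.toAdd.injective h1
  rw [← Subgroup.relIndex_inf_mul_relIndex, Subgroup.relIndex_comap, himA, Subgroup.relIndex_comap, himB,
    AddSubgroup.relIndex_toSubgroup, AddSubgroup.relIndex_toSubgroup]

/-! ## §3 Scaling indices: `[O : t²O] = [O : tO]²`, `[O : t⁴O] = [O : t²O]²` -/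

/-- `c·(d·A) = (c·d)·A`. [cite: DummitFoote2004, §3.3] -/
theorem map_mulLeft_map_mulLeft (c d : K) (A : AddSubgroup K) :
    (A.map (AddMonoidHom.mulLeft d)).map (AddMonoidHom.mulLeft c) = A.map (AddMonoidHom.mulLeft (c * d)) := by
  rw [AddSubgroup.map_map]
  congr 1
  ext x
  simp [mul_assoc]

/-- **`[O : (c·c)·O] = [O : c·O]²`** for an additive subgroup `O` with `c·O ≤ O`, `c ≠ 0` (`[O : c²O] = [O : cO]·[cO : c²O]` and `x ↦ cx` is injective).
[cite: DummitFoote2004, §3.3] -/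
theorem relIndex_map_mulLeft_mul_self {c : K} (hc : c ≠ 0) (O : AddSubgroup K) (hcO : O.map (AddMonoidHom.mulLeft c) ≤ O) :
    (O.map (AddMonoidHom.mulLeft (c * c))).relIndex O = (O.map (AddMonoidHom.mulLeft c)).relIndex O ^ 2 := by
  have hinj : Function.Injective (AddMonoidHom.mulLeft c : K →+ K) := fun x y h => mul_left_cancel₀ hc (by simpa using h)
  have hle : O.map (AddMonoidHom.mulLeft (c * c)) ≤ O.map (AddMonoidHom.mulLeft c) := by
    rw [← map_mulLeft_map_mulLeft]; exact AddSubgroup.map_mono hcO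
  rw [← AddSubgroup.relIndex_mul_relIndex _ _ _ hle hcO, ← map_mulLeft_map_mulLeft, AddSubgroup.relIndex_map_map_of_injective _ _ hinj, sq]

include hOp hOm hsurj hw₁ hw₂ in
/-- **THE INDEX OF THE WEIGHT MAP ON THE BOX: `[D : φD] = Q·Q² = Q³`.**  With `D = Θ₁⁻¹(O⁺) ⊓ Θ₂⁻¹(O⁻)`, `φ` of weights `(t², t⁴)`, `t ≠ 0`, `t·O⁺ ≤ O⁺`,
`t²·O⁻ ≤ O⁻`, and the frame's index letters `[O⁺ : tO⁺]² = Q`, `[O⁻ : t²O⁻] = Q` (★ `K2E3LocalLatticeScalingIndex` at the place):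
`(φD).relIndex D = Q ^ 3` — HC's `d(u)∕2 = 3` for the regular class relative to `Q = [𝒪_K : t𝒪_K]`.
[cite: HarishChandra1999AdmissibleDistributions, §3.1 Lemma 3.2] [cite: Rogawski1990, §8.1 Prop. 8.1.2 (b) p. 114] -/
theorem relIndex_box_eq_pow_three {t : K} (ht : t ≠ 0) (hst : s = t * t)
    (htOp : Op.map (AddMonoidHom.mulLeft t) ≤ Op) (htOm : Om.map (AddMonoidHom.mulLeft (t * t)) ≤ Om)
    {Q : ℕ} (hFp : (Op.map (AddMonoidHom.mulLeft t)).relIndex Op ^ 2 = Q) (hFm : (Om.map (AddMonoidHom.mulLeft (t * t))).relIndex Om = Q) :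
    (((AddSubgroup.toSubgroup Op).comap Θ₁ ⊓ (AddSubgroup.toSubgroup Om).comap Θ₂).map φ.toMonoidHom).relIndex
        ((AddSubgroup.toSubgroup Op).comap Θ₁ ⊓ (AddSubgroup.toSubgroup Om).comap Θ₂) = Q ^ 3 := by
  have hs : s ≠ 0 := by rw [hst]; exact mul_ne_zero ht ht
  rw [map_box_eq Θ₁ Θ₂ φ Op Om hw₁ hw₂ hs]
  rw [relIndex_box_eq_mul σ Θ₁ Θ₂ Op Om hOp hOm hsurj le_rfl le_rfl, hst, relIndex_map_mulLeft_mul_self ht Op htOp, hFp,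
    show (t * t) ^ 2 = (t * t) * (t * t) from sq _, relIndex_map_mulLeft_mul_self (mul_ne_zero ht ht) Om htOm, hFm]
  exact (pow_succ' Q 2).symm

end Box

end Summit.HodgeConjecture.HodgeConjecture.Cruxes.H413.K2E3UnipotentOrbitalScalingRegularIndex
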